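import Literature.NumberTheory.EllipticCurves.QuadraticTwistRationalTorsionFiniteProofs
import Literature.NumberTheory.EllipticCurves.BSDRankZeroDensityProofs
import Literature.NumberTheory.EllipticCurves.GoldfeldProportionsCremona19a3
import Literature.NumberTheory.EllipticCurves.KummerSelmerGroupFinite
import HarnessLib

/-!
# The Cassels–Tate parity bridge in quadratic twist families:
# "`dim_{𝔽_p} Sel_p(E^{(s)}) = 1` for at least `δ` of the twists" ⟹ "`corank_{ℤ_p} Sel_{p^∞}(E^{(s)}) = 1`
# for at least `δ` of the twists" (`p` odd), PROVED — and the `19a3` instance of BKLOS 2019 / Keller–Yin 2024b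

`Proofs` file (theorems only; no definition, no named fact — D-0014/D-0026) in topic
`Literature/NumberTheory/EllipticCurves`, cross-ladder literature-typing layer (cell
`bsd-littype`, seat 08). Honest framing of the cell: "no tranche here proves BSD; typed ≠ proved ≠
endorsed". This file closes, IN THE KERNEL, the step that the tree file
`GoldfeldProportionsCremona19a3.lean` (seat 06) records as missing (its module docstring: "The
passage from item 2 (b) [BKLOS: at least `41.6̄%` of the twists of `19a3` have `3`-Selmer rank `1`]
to the `5/12` clause of item 3 (B) [Keller–Yin Cor. 3.8.1] additionally needs the parity bridge
`dim_{𝔽₃} Sel_3 = 1 ⇒ corank_{ℤ₃} Sel_{3^∞} = 1` (off the finitely many classes with rational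
`3`-torsion) and monotonicity of `SquareClassProportionGe` […], neither in the tree") — the
monotonicity half landed as `SquareClassProportionGe.mono` (seat 08, gen 3); here is the parity half.

## The printed argument being formalised

Castella–Wan, Math. Ann. 389 (2024), proof of Cor. B (authors' MS p. 2), VERBATIM: "the natural
surjection `Sel_p(E/ℚ) → Sel_{p^∞}(E/ℚ)[p]` is an isomorphism. By the exact sequence (1.1) and the
non-degeneracy of the Cassels–Tate pairing on `Ш(E/ℚ)/Ш(E/ℚ)_{div}`, we thus see that
`Sel_p(E/ℚ) ≃ ℤ/pℤ ⟹ Sel_{p^∞}(E/ℚ) ≃ ℚ_p/ℤ_p`"; Burungale–Tian, Invent. Math. 220 (2020), proof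
of Cor. 1.4 (p. 215), VERBATIM: "In view of (i) and (ii), `corank_{ℤ_p} Sel_{p^∞}(E/ℚ) = 1`. Indeed,
we note `Sel_p(E/ℚ) = Sel_{p^∞}(E/ℚ)[p]` if `E(ℚ)[p] = 0`." In the tree this count is Dokchitser's
`dim_{𝔽_p} Sel_p = dim E(K)[p] + corank_{ℤ_p} Sel_{p^∞} + 2m` (`exists_selmerRank_eq_add`, file
`BSDRankZeroDensityProofs`, granted the Cassels–Tate pairing as the named fact
`WeierstrassCurve.exists_casselsTate_pairing`, Silverman *AEC* X.4.14) — so `#Sel_p = p` and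
`#E(K)[p] = 1` force `corank = 1` (§1). In a quadratic twist family `{E^{(s)}}` the hypothesis
`E^{(s)}(K)[p] = 0` fails only on finitely many square classes when `p` is odd (Mazur–Rubin 2010
Lemma 5.5, tree theorem `finite_setOf_twistClass_natCard_torsionBy_ne_one`), and a lower
proportion `liminf #{t : H(t) < X, P t}/#{t : H(t) < X} ≥ δ` (`SquareClassProportionGe`, BKLOS height)
is unchanged by altering `P` on a finite set of classes because `#{t : H(t) < X} → ∞` (§2–§3:
`K^×/(K^×)²` is infinite — every prime `v` of `K` carries a class of odd `v`-valuation, of height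
`≥ N(v)`, and `K` has primes of arbitrarily large norm).

## Contents

* §1 `selmerCorank_eq_one_of_card_selmerGroup_eq_of_natCard_torsionBy_eq_one` — the pointwise
  bridge over any number field (granted `hCT`); `selmerCorank_eq_zero_of_card_selmerGroup_eq_one`
  (the rank-`0` companion, `Sel_p = 0 ⟹ corank 0`).
* §2 `exists_le_squareClassHeight`, `infinite_squareClass`,
  `tendsto_natCard_squareClassHeight_lt_atTop` — `#Σ(X) → ∞`.
* §3 `SquareClassProportionGe.of_imp_off_finite` — "at least `δ`" is stable under implications
  that hold off a finite set of classes.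
* §4 `squareClassProportionGe_twist_selmerCorank_one_of_card_selmerGroup` — **THE BRIDGE**: for
  `V/K` elliptic, `p` an odd prime, granted Cassels–Tate: "`#Sel_p(V^{(s)}) = p` for at least `δ` of
  `t = [s]`" ⟹ "`corank_{ℤ_p} Sel_{p^∞}(V^{(s)}) = 1` for at least `δ` of `t`"; and its composition
  with any pointwise `p`-converse (`…_of_pConverse`); the rank-`0` companion
  `squareClassProportionGe_twist_selmerCorank_zero_of_card_selmerGroup_eq_one` (any `p`); the `p = 2`
  bridge `…_of_card_selmerGroup_two` (no exceptional classes when `V(K)[2] = 0`).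
* §5 the `19a3` instance: BKLOS 2019 §2 (tree fact
  `BhargavaKlagsbrunLemkeOliverShnidman2019.cremona19a3_rankZero_selmerRankOne_proportions`, REFEREED)
  ⟹ at least `5/12` of the quadratic twists of `19a3` have `corank_{ℤ₃} Sel_{3^∞} = 1`
  (`cremona19a3_proportion_selmerCorank_three_eq_one`), hence — granted ONLY the pointwise clause (A)
  of Keller–Yin's Cor. 3.8.1 at corank `1` — at least `5/12` have algebraic and analytic rank `1`
  (`KellerYin2024.cremona19a3_proportion_rank_one_of_pointwise`): the first proportion clause of
  the PREPRINT claim `KellerYin2024.cor381_cremona19a3_twists_OPEN` (B) is thereby a kernel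
  consequence of its clause (A) + BKLOS + Cassels–Tate, no longer free-standing.
* §6 `SquareClassProportionGe.infinite_setOf` — "at least `δ > 0`" ⟹ infinitely many classes
  (and the `19a3` instances: infinitely many classes of corank-`1`, resp. rank-`0`, twists).
* §7 Burungale–Tian 2026 Thm. 3.5 / Prop. 1.3 (tree facts) in the form "infinitely many square
  classes `t ∈ K^×/(K^×)²` with `corank_{ℤ₃} Sel_{3^∞}(E^{(t)}/K) = 0`, resp. `ord_{s=1} L(E^{(t)}/K, s) = 0`".
* §8 `SquareClassProportionGe.add_of_disjoint` (proportions of disjoint properties add) and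
  Keller–Yin Cor. 3.8.1 (B3) "`2/3 = 5/12 + 1/4`" derived from (B1) + (B2)
  (`KellerYin2024.cremona19a3_proportion_rank_eq_analyticRank_of_clauses`,
  `…_proportions_of_pointwise_of_rank_zero`).

## References

* [CastellaWan2023] F. Castella, X. Wan, Math. Ann. 389 (2024), Cor. B, proof (p. 2596; MS p. 2).
* [BurungaleTian2019] A. Burungale, Y. Tian, Invent. Math. 220 (2020), Cor. 1.4, proof (p. 215).
* [Dokchitser2013ParityNotes] T. Dokchitser, *Notes on the parity conjecture*, §2 (`rk_p = rk + δ_p`).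
* [MazurRubin2010] B. Mazur, K. Rubin, Invent. Math. 181 (2010), Lemma 5.5.
* [BhargavaKlagsbrunLemkeOliverShnidman2019] Duke Math. J. 168 (2019), §2 (`H(s)`, `Σ(X)`,
  Thm. 2.5 (b), the `19a3` paragraph; proof of Thm. 2.5, §5: "`3`-Selmer rank").
* [KellerYin2024PotOrd] T. Keller, M. Yin, arXiv:2410.23241v1, Cor. 3.8.1 (PREPRINT claim; only
  its pointwise clause (A) is used, as a hypothesis).
* [SilvermanAEC2009] Thm. X.4.14 (Cassels–Tate pairing).
* [BurungaleTian2026] A. A. Burungale, Y. Tian, Ann. of Math. 203 (2026), Prop. 1.3, Thm. 3.5, §3.2.2.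
-/

noncomputable section

open scoped Classical AddSubgroup
open Filter Topology
open WeierstrassCurve IsDedekindDomain NumberField

universe u

namespace Literature.NumberTheory.EllipticCurves

/-! ## §1 The pointwise bridge: `#Sel_p = p`, `E(K)[p] = 0` ⟹ `corank_{ℤ_p} Sel_{p^∞} = 1` -/

section Pointwise

variable {K : Type u} [Field K] [NumberField K]

/-- **`Sel_p(E/K) ≃ ℤ/pℤ` and `E(K)[p] = 0` force `corank_{ℤ_p} Sel_{p^∞}(E/K) = 1`** (granted the
Cassels–Tate pairing `hCT`): the printed step "`Sel_p = Sel_{p^∞}[p]` if `E(K)[p] = 0` … by the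
non-degeneracy of the Cassels–Tate pairing on `Ш/Ш_div`, `Sel_p ≃ ℤ/pℤ ⟹ Sel_{p^∞} ≃ ℚ_p/ℤ_p`", here
for every elliptic curve over every number field and every prime `p`, via the tree's parity count
`dim Sel_p = dim E(K)[p] + corank + 2m` (`exists_selmerRank_eq_add`) with `s = 1`, `t = 0`.
[cite: CastellaWan2023, Cor. B, proof (p. 2596)] [cite: BurungaleTian2019, Cor. 1.4, proof (p. 215)]
[cite: Dokchitser2013ParityNotes, §2] -/
theorem selmerCorank_eq_one_of_card_selmerGroup_eq_of_natCard_torsionBy_eq_one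
    (hCT : exists_casselsTate_pairing (K := K)) (W : WeierstrassCurve K) [W.IsElliptic] (p : ℕ)
    [Fact p.Prime] (hSel : Nat.card (W.selmerGroup p) = p)
    (htors : Nat.card (AddSubgroup.torsionBy W.toAffine.Point (p : ℤ)) = 1) :
    W.selmerCorank p = 1 := by
  have hs : Nat.card (W.selmerGroup p) = p ^ 1 := by rw [pow_one]; exact hSel
  obtain ⟨m, hm⟩ := exists_selmerRank_eq_add hCT W p 1 0 hs (by rw [pow_zero]; convert htors)
  omega

/-- **The general parity constraint read as a bound**: `#Sel_p(E/K) = p^s`, `#E(K)[p] = p^t` ⟹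
`corank_{ℤ_p} Sel_{p^∞}(E/K) ≤ s - t` and `corank ≡ s - t (mod 2)` (granted Cassels–Tate).
[cite: Dokchitser2013ParityNotes, §2 (rk_p = rk + δ_p, Ш[p^∞] ≅ (ℚ_p/ℤ_p)^δ × square order)] -/
theorem selmerCorank_le_and_even_of_card (hCT : exists_casselsTate_pairing (K := K))
    (W : WeierstrassCurve K) [W.IsElliptic] (p : ℕ) [Fact p.Prime] (s t : ℕ)
    (hs : Nat.card (W.selmerGroup p) = p ^ s)
    (ht : Nat.card (AddSubgroup.torsionBy W.toAffine.Point (p : ℤ)) = p ^ t) :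
    W.selmerCorank p ≤ s - t ∧ Even (s - t - W.selmerCorank p) := by
  obtain ⟨m, hm⟩ := exists_selmerRank_eq_add hCT W p s t hs (by convert ht)
  exact ⟨by omega, ⟨m, by omega⟩⟩

/-- **`Sel_p(E/K) = 0 ⟹ corank_{ℤ_p} Sel_{p^∞}(E/K) = 0`** ("`p`-Selmer rank `0`", the case of
BKLOS Thm. 2.5 (a) / Thm. 2.6 as established in their proofs, §9.2: "every twist within `T_0(φ)` has
even `3`-Selmer rank, so … at least `50%` of the twists in `T_0(φ)` have rank `0`"): by the descent
count `#Sel_p = p^{rk}·#E(K)[p]·#(Ш ⊓ H¹[p])` (`natCard_selmerGroup_eq`) `#Sel_p = 1` forces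
`#E(K)[p] = 1`, and the parity count with `s = t = 0` gives `corank = 0` (granted `hCT`; the tree's
`selmerCorank_eq_zero_of_natCard_selmerGroup_eq_one_factFree`, file `SelmerTrivialCorankProofs`, is
the Cassels–Tate-free form for `K : Type`). [cite: BhargavaKlagsbrunLemkeOliverShnidman2019, §9.2 (proof of Thm. 2.5, chunk p0014 L43–L47)]
[cite: Dokchitser2013ParityNotes, §2] -/
theorem selmerCorank_eq_zero_of_card_selmerGroup_eq_one
    (hCT : exists_casselsTate_pairing (K := K)) (W : WeierstrassCurve K) [W.IsElliptic] (p : ℕ)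
    [hp : Fact p.Prime] (hSel : Nat.card (W.selmerGroup p) = 1) : W.selmerCorank p = 0 := by
  have hdesc := W.natCard_selmerGroup_eq hp.out.ne_zero
  rw [hSel] at hdesc
  have htors : Nat.card (AddSubgroup.torsionBy W.toAffine.Point (p : ℤ)) = 1 :=
    Nat.eq_one_of_mul_eq_one_left (Nat.eq_one_of_mul_eq_one_right hdesc.symm)
  have hs : Nat.card (W.selmerGroup p) = p ^ 0 := by rw [pow_zero]; exact hSel
  obtain ⟨m, hm⟩ := exists_selmerRank_eq_add hCT W p 0 0 hs (by rw [pow_zero]; convert htors)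
  omega

end Pointwise

/-! ## §2 `K^×/(K^×)²` is infinite; `#Σ(X) → ∞` -/

section Counting

variable (K : Type u) [Field K] [NumberField K]

/-- There are primes of `K` of norm `≥ X`, for every `X`: every rational prime `p` lies below
some prime of `K` (going up along the integral extension `ℤ → 𝓞_K`, Mathlib
`Ideal.exists_maximal_ideal_liesOver_of_isIntegral`; Neukirch I §8), distinct rational primes lie
below distinct primes (a prime containing `p` and `q ≠ p` contains `1`), so `K` has infinitely many
primes, while only finitely many have norm `< X` (Mathlib `Ideal.finite_setOf_absNorm_le`). (The
infinitude is also the tree's `Literature.NumberTheory.Automorphic.infinite_heightOneSpectrum`,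
stated there for `K : Type`; it is re-derived inline here for a universe-polymorphic `K`.) [folklore] -/
private theorem exists_heightOneSpectrum_le_absNorm (X : ℕ) :
    ∃ v : HeightOneSpectrum (𝓞 K), X ≤ Ideal.absNorm v.asIdeal := by
  -- every rational prime lies in some prime of `K`
  have hmem : ∀ p : Nat.Primes, ∃ v : HeightOneSpectrum (𝓞 K), ((p : ℕ) : 𝓞 K) ∈ v.asIdeal := by
    intro p
    have hp : (p : ℕ).Prime := p.2
    haveI : (Ideal.span {((p : ℕ) : ℤ)}).IsMaximal :=
      Ideal.IsPrime.isMaximal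
        ((Ideal.span_singleton_prime (by exact_mod_cast hp.ne_zero)).mpr
          (Nat.prime_iff_prime_int.mp hp))
        (by
          rw [ne_eq, Ideal.span_singleton_eq_bot]
          exact_mod_cast hp.ne_zero)
    obtain ⟨Q, hQmax, hQover⟩ :=
      Ideal.exists_maximal_ideal_liesOver_of_isIntegral (S := 𝓞 K) (Ideal.span {((p : ℕ) : ℤ)})
    have hpQ : ((p : ℕ) : 𝓞 K) ∈ Q := by
      have h : ((p : ℕ) : ℤ) ∈ Q.under ℤ := by
        rw [← hQover.over]
        exact Ideal.mem_span_singleton_self _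
      simpa using (Ideal.mem_comap.mp h)
    have hQbot : Q ≠ ⊥ := by
      intro hbot
      rw [hbot, Ideal.mem_bot] at hpQ
      exact hp.ne_zero (by exact_mod_cast hpQ)
    exact ⟨⟨Q, hQmax.isPrime, hQbot⟩, hpQ⟩
  -- hence infinitely many primes of `K`
  haveI : Infinite (HeightOneSpectrum (𝓞 K)) := by
    choose v hv using hmem
    refine Infinite.of_injective v fun p q hpq ↦ ?_
    by_contra hne
    have hne' : (p : ℕ) ≠ q := fun h ↦ hne (Subtype.ext h)
    have hcop : IsCoprime ((p : ℕ) : ℤ) ((q : ℕ) : ℤ) :=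
      Nat.isCoprime_iff_coprime.mpr ((Nat.coprime_primes p.2 q.2).mpr hne')
    obtain ⟨a, b, hab⟩ := hcop
    apply (v q).isPrime.ne_top
    rw [Ideal.eq_top_iff_one]
    have h1 : (1 : 𝓞 K) = (a : 𝓞 K) * (p : ℕ) + (b : 𝓞 K) * (q : ℕ) := by exact_mod_cast hab.symm
    rw [h1]
    refine Ideal.add_mem _ (Ideal.mul_mem_left _ _ ?_) (Ideal.mul_mem_left _ _ (hv q))
    rw [← hpq]
    exact hv p
  have hfin : {v : HeightOneSpectrum (𝓞 K) | Ideal.absNorm v.asIdeal < X}.Finite := by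
    have hinj : Set.InjOn (fun v : HeightOneSpectrum (𝓞 K) ↦ v.asIdeal)
        ((fun v : HeightOneSpectrum (𝓞 K) ↦ v.asIdeal) ⁻¹' {I : Ideal (𝓞 K) | Ideal.absNorm I ≤ X}) :=
      fun v _ w _ h ↦ HeightOneSpectrum.ext h
    refine ((Ideal.finite_setOf_absNorm_le (S := 𝓞 K) X).preimage hinj).subset fun v hv ↦ ?_
    simp only [Set.mem_preimage, Set.mem_setOf_eq]
    exact le_of_lt hv
  obtain ⟨v, hv⟩ := hfin.infinite_compl.nonempty
  exact ⟨v, not_lt.mp hv⟩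

variable {K}

/-- **Square classes of arbitrarily large height**: for every `X` there is `t ∈ K^×/(K^×)²` with
`H(t) ≥ X` — the class of a uniformiser `π_v` at a prime `v` with `N(v) ≥ X` has odd `v`-valuation,
so `N(v) ≤ H(t)` (`absNorm_le_squareClassHeight_of_ne_one`). BKLOS 2019, §2 (the height `H(s)`).
[cite: BhargavaKlagsbrunLemkeOliverShnidman2019, §2 (definition of H(s))] -/
theorem exists_le_squareClassHeight (X : ℕ) : ∃ t : SquareClass K, X ≤ squareClassHeight t := by
  obtain ⟨v, hv⟩ := exists_heightOneSpectrum_le_absNorm K X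
  obtain ⟨π, hπ⟩ := v.valuation_exists_uniformizer K
  have hπ0 : π ≠ 0 := by
    intro h0
    rw [h0, map_zero] at hπ
    exact WithZero.coe_ne_zero hπ.symm
  set x : Kˣ := Units.mk0 π hπ0 with hx
  refine ⟨QuotientGroup.mk x, hv.trans (absNorm_le_squareClassHeight_of_ne_one _ v ?_)⟩
  rw [ne_eq, HeightOneSpectrum.valuationOfNeZeroMod_mk_eq_one_iff,
    HeightOneSpectrum.toAdd_valuationOfNeZero_eq_log]
  have hval : v.valuation K (x : K) = WithZero.exp (-1 : ℤ) := by rw [hx, Units.val_mk0, hπ]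
  rw [hval, WithZero.log_exp]
  omega

/-- **`K^×/(K^×)²` is infinite** (heights are unbounded, `exists_le_squareClassHeight`).
[cite: BhargavaKlagsbrunLemkeOliverShnidman2019, §2 (squareclasses s ∈ F*/F*², the sets Σ(X))] -/
theorem infinite_squareClass : Infinite (SquareClass K) := by
  by_contra hfin
  rw [not_infinite_iff_finite] at hfin
  obtain ⟨t₀, ht₀⟩ := Finite.exists_max (squareClassHeight (K := K))
  obtain ⟨t, ht⟩ := exists_le_squareClassHeight (K := K) (squareClassHeight t₀ + 1)
  exact absurd ((ht.trans (ht₀ t))) (by omega)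

/-- **`#Σ(X) = #{t ∈ K^×/(K^×)² : H(t) < X} → ∞`** as `X → ∞` (BKLOS 2019, §2: the denominators of
all twist proportions): any `N` classes have height `< X` for `X` large, and `K^×/(K^×)²` is
infinite. [cite: BhargavaKlagsbrunLemkeOliverShnidman2019, §2 (the sets Σ(X))] -/
theorem tendsto_natCard_squareClassHeight_lt_atTop :
    Tendsto (fun X : ℕ ↦ Nat.card {t : SquareClass K | squareClassHeight t < X}) atTop atTop := by
  haveI := infinite_squareClass (K := K)
  refine tendsto_atTop_atTop.mpr fun N ↦ ?_
  obtain ⟨T, hT⟩ := Infinite.exists_subset_card_eq (SquareClass K) N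
  refine ⟨T.sup squareClassHeight + 1, fun X hX ↦ ?_⟩
  have hsub : (T : Set (SquareClass K)) ⊆ {t : SquareClass K | squareClassHeight t < X} := by
    intro t ht
    simp only [Set.mem_setOf_eq]
    have h1 : squareClassHeight t ≤ T.sup squareClassHeight := Finset.le_sup (Finset.mem_coe.mp ht)
    omega
  calc N = Nat.card (T : Set (SquareClass K)) := by rw [Nat.card_coe_set_eq, Set.ncard_coe_finset, hT]
    _ ≤ Nat.card {t : SquareClass K | squareClassHeight t < X} :=
        Nat.card_mono (finite_setOf_squareClassHeight_lt X) hsub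

/-- The same for the real-valued counts. [cite: BhargavaKlagsbrunLemkeOliverShnidman2019, §2 (the sets Σ(X))] -/
theorem tendsto_natCard_squareClassHeight_lt_atTop_real :
    Tendsto (fun X : ℕ ↦ (Nat.card {t : SquareClass K | squareClassHeight t < X} : ℝ)) atTop atTop :=
  tendsto_natCast_atTop_atTop.comp tendsto_natCard_squareClassHeight_lt_atTop

end Counting

/-! ## §3 "At least `δ` of the classes" is insensitive to finitely many classes -/

section Transfer

variable {K : Type u} [Field K] [NumberField K]

/-- **Implications off a finite set transport lower proportions**: if `P(t) ⟹ Q(t)` for every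
square class `t` outside a finite set `F`, then "at least `δ` of `t` satisfy `P`" implies "at least
`δ` of `t` satisfy `Q`". Indeed `#{H < X, P} ≤ #{H < X, Q} + #F`, and `#F/#Σ(X) → 0` because
`#Σ(X) → ∞` (`tendsto_natCard_squareClassHeight_lt_atTop`). This is the form in which "for all but
finitely many twists" hypotheses (Mazur–Rubin 2010, Lemma 5.5) enter BKLOS-type proportions.
[cite: BhargavaKlagsbrunLemkeOliverShnidman2019, §2 (Σ(X), "the proportion of twists")]
[cite: MazurRubin2010, Lemma 5.5 ("for all but finitely many quadratic twists")] -/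
theorem SquareClassProportionGe.of_imp_off_finite {P Q : SquareClass K → Prop}
    {F : Set (SquareClass K)} (hF : F.Finite) (hPQ : ∀ t ∉ F, P t → Q t) {δ : ℝ}
    (h : SquareClassProportionGe P δ) : SquareClassProportionGe Q δ := by
  unfold SquareClassProportionGe at h ⊢
  -- notation
  set n : ℕ → ℝ := fun X ↦ (Nat.card {t : SquareClass K | squareClassHeight t < X} : ℝ) with hn
  set a : ℕ → ℝ := fun X ↦
    (Nat.card {t : SquareClass K | squareClassHeight t < X ∧ P t} : ℝ) / n X with ha
  set b : ℕ → ℝ := fun X ↦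
    (Nat.card {t : SquareClass K | squareClassHeight t < X ∧ Q t} : ℝ) / n X with hb
  set e : ℕ → ℝ := fun X ↦ (hF.toFinset.card : ℝ) / n X with he
  change δ ≤ liminf a atTop at h
  change δ ≤ liminf b atTop
  -- the counting inequality `a X ≤ b X + e X`
  have hcount : ∀ X : ℕ, Nat.card {t : SquareClass K | squareClassHeight t < X ∧ P t} ≤
      Nat.card {t : SquareClass K | squareClassHeight t < X ∧ Q t} + hF.toFinset.card := by
    intro X
    have hsub : {t : SquareClass K | squareClassHeight t < X ∧ P t} ⊆
        {t : SquareClass K | squareClassHeight t < X ∧ Q t} ∪ F := by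
      intro t ht
      by_cases htF : t ∈ F
      · exact Or.inr htF
      · exact Or.inl ⟨ht.1, hPQ t htF ht.2⟩
    calc Nat.card {t : SquareClass K | squareClassHeight t < X ∧ P t}
        = {t : SquareClass K | squareClassHeight t < X ∧ P t}.ncard := Nat.card_coe_set_eq _
      _ ≤ ({t : SquareClass K | squareClassHeight t < X ∧ Q t} ∪ F).ncard :=
          Set.ncard_le_ncard hsub ((finite_setOf_squareClassHeight_lt_and X Q).union hF)
      _ ≤ {t : SquareClass K | squareClassHeight t < X ∧ Q t}.ncard + F.ncard := Set.ncard_union_le _ _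
      _ = Nat.card {t : SquareClass K | squareClassHeight t < X ∧ Q t} + hF.toFinset.card := by
          rw [Nat.card_coe_set_eq, Set.ncard_eq_toFinset_card F hF]
  have hn0 : ∀ X : ℕ, 0 ≤ n X := fun X ↦ by simp only [hn]; exact Nat.cast_nonneg _
  have hab : ∀ X : ℕ, a X ≤ b X + e X := by
    intro X
    simp only [ha, hb, he]
    rw [← add_div]
    exact div_le_div_of_nonneg_right (by exact_mod_cast hcount X) (hn0 X)
  -- `e X → 0`
  have he0 : Tendsto e atTop (𝓝 0) :=
    tendsto_const_nhds.div_atTop tendsto_natCard_squareClassHeight_lt_atTop_real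
  -- boundedness of the ratios
  have hb1 : ∀ X, b X ≤ 1 := fun X ↦ by
    simp only [hb, hn]
    refine div_le_one_of_le₀ ?_ (Nat.cast_nonneg _)
    have hsub : {t : SquareClass K | squareClassHeight t < X ∧ Q t} ⊆
        {t : SquareClass K | squareClassHeight t < X} := fun t ht ↦ ht.1
    exact_mod_cast Nat.card_mono (finite_setOf_squareClassHeight_lt X) hsub
  have ha0 : ∀ X, 0 ≤ a X := fun X ↦ by
    simp only [ha]
    exact div_nonneg (Nat.cast_nonneg _) (hn0 X)
  -- `δ ≤ liminf b`: every `c < δ` is eventually below `b`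
  refine le_of_forall_lt_imp_le_of_dense fun c hc ↦ ?_
  have hc' : (c + δ) / 2 < liminf a atTop := by linarith [h]
  have hev₁ : ∀ᶠ X in atTop, (c + δ) / 2 < a X :=
    eventually_lt_of_lt_liminf hc' (isBoundedUnder_of ⟨0, fun X ↦ ha0 X⟩)
  have hev₂ : ∀ᶠ X in atTop, e X < (δ - c) / 2 := by
    have hpos : 0 < (δ - c) / 2 := by linarith
    exact (tendsto_order.1 he0).2 _ hpos
  have hev : ∀ᶠ X in atTop, c ≤ b X := by
    filter_upwards [hev₁, hev₂] with X h₁ h₂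
    linarith [hab X]
  exact le_liminf_of_le
    (Filter.IsBoundedUnder.isCoboundedUnder_ge (isBoundedUnder_of ⟨1, fun X ↦ hb1 X⟩)) hev

end Transfer

/-! ## §4 The bridge in a twist family -/

section Bridge

variable {K : Type u} [Field K] [NumberField K]

/-- **The parity bridge in a quadratic twist family** (granted Cassels–Tate `hCT`): for an
elliptic curve `V` over a number field `K`, an odd prime `p` and `δ ∈ ℝ`, if at least `δ` of the
square classes `t` have `#Sel_p(V^{(s)}/K) = p` for all representatives `s` of `t` ("`p`-Selmer
rank `1`", BKLOS 2019 Thm. 2.5 (b)), then at least `δ` of the classes have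
`corank_{ℤ_p} Sel_{p^∞}(V^{(s)}/K) = 1`. Proof: off the finite set of classes with
`V^{(s)}(K)[p] ≠ 0` (Mazur–Rubin 2010 Lemma 5.5, `finite_setOf_twistClass_natCard_torsionBy_ne_one`)
the pointwise bridge `selmerCorank_eq_one_of_card_selmerGroup_eq_of_natCard_torsionBy_eq_one`
applies, and lower proportions ignore finite sets (`SquareClassProportionGe.of_imp_off_finite`).
[cite: BhargavaKlagsbrunLemkeOliverShnidman2019, Thm. 2.5 (b) and §5 (proof: "3-Selmer rank")]
[cite: MazurRubin2010, Lemma 5.5] [cite: Dokchitser2013ParityNotes, §2] -/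
theorem squareClassProportionGe_twist_selmerCorank_one_of_card_selmerGroup
    (hCT : exists_casselsTate_pairing (K := K)) (V : WeierstrassCurve K) [V.IsElliptic] (p : ℕ)
    [hp : Fact p.Prime] (hp2 : p ≠ 2) {δ : ℝ}
    (h : SquareClassProportionGe
      (TwistClassSatisfies V fun E : WeierstrassCurve K ↦ Nat.card (E.selmerGroup p) = p) δ) :
    SquareClassProportionGe
      (TwistClassSatisfies V fun E : WeierstrassCurve K ↦ E.selmerCorank p = 1) δ := by
  refine SquareClassProportionGe.of_imp_off_finite
    (finite_setOf_twistClass_natCard_torsionBy_ne_one V (hp.out.odd_of_ne_two hp2))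
    (fun t ht hP s hs ↦ ?_) h
  haveI : (V.quadraticTwist (s : K)).IsElliptic := V.isElliptic_quadraticTwist s.ne_zero
  exact selmerCorank_eq_one_of_card_selmerGroup_eq_of_natCard_torsionBy_eq_one hCT _ p (hP s hs)
    (natCard_torsionBy_quadraticTwist_eq_one_of_not_mem V ht s hs)

/-- **Bridge + pointwise `p`-converse**: if moreover every twist `V^{(s)}` (`s ∈ K^×`) with
`corank_{ℤ_p} Sel_{p^∞} = 1` satisfies a property `R` (e.g. "`rk = ord_{s=1} L = 1`", a
`p`-converse theorem supplied as the hypothesis `hconv`), then at least `δ` of the classes satisfy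
`R` for all their representatives. [cite: BhargavaKlagsbrunLemkeOliverShnidman2019, Thm. 2.5 (b)]
[cite: MazurRubin2010, Lemma 5.5] -/
theorem squareClassProportionGe_twist_of_card_selmerGroup_of_pConverse
    (hCT : exists_casselsTate_pairing (K := K)) (V : WeierstrassCurve K) [V.IsElliptic] (p : ℕ)
    [Fact p.Prime] (hp2 : p ≠ 2) {R : WeierstrassCurve K → Prop}
    (hconv : ∀ s : Kˣ, (V.quadraticTwist (s : K)).selmerCorank p = 1 → R (V.quadraticTwist (s : K)))
    {δ : ℝ}
    (h : SquareClassProportionGe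
      (TwistClassSatisfies V fun E : WeierstrassCurve K ↦ Nat.card (E.selmerGroup p) = p) δ) :
    SquareClassProportionGe (TwistClassSatisfies V R) δ :=
  SquareClassProportionGe.mono (fun _ ht (s : Kˣ) hs ↦ hconv s (ht s hs))
    (squareClassProportionGe_twist_selmerCorank_one_of_card_selmerGroup hCT V p hp2 h)

/-- **The rank-`0` companion (any prime `p`, no exceptional classes)**: "`Sel_p(V^{(s)}) = 0` for at
least `δ` of the classes" ⟹ "`corank_{ℤ_p} Sel_{p^∞}(V^{(s)}) = 0` for at least `δ` of the classes"
(pointwise `selmerCorank_eq_zero_of_card_selmerGroup_eq_one`, granted `hCT`; monotonicity). This is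
the Selmer form in which BKLOS prove Thm. 2.5 (a) / Thm. 2.6 / Thm. 2.7 (§9.2), the input currency of
the rank-`0` `p`-converses (e.g. Burungale–Tian Thm. 1.1 at `p = 3`, `burungaleTian_thm35_…`).
[cite: BhargavaKlagsbrunLemkeOliverShnidman2019, §9.2 (proof of Thms. 2.5–2.7, chunk p0014 L43–L47)] -/
theorem squareClassProportionGe_twist_selmerCorank_zero_of_card_selmerGroup_eq_one
    (hCT : exists_casselsTate_pairing (K := K)) (V : WeierstrassCurve K) [V.IsElliptic] (p : ℕ)
    [Fact p.Prime] {δ : ℝ}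
    (h : SquareClassProportionGe
      (TwistClassSatisfies V fun E : WeierstrassCurve K ↦ Nat.card (E.selmerGroup p) = 1) δ) :
    SquareClassProportionGe
      (TwistClassSatisfies V fun E : WeierstrassCurve K ↦ E.selmerCorank p = 0) δ := by
  refine SquareClassProportionGe.mono (fun _ ht (s : Kˣ) hs ↦ ?_) h
  haveI : (V.quadraticTwist (s : K)).IsElliptic := V.isElliptic_quadraticTwist s.ne_zero
  exact selmerCorank_eq_zero_of_card_selmerGroup_eq_one hCT _ p (ht s hs)

/-- **The bridge at `p = 2`, no exceptional classes**: if `V(K)[2] = 0` then EVERY twist has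
`V^{(s)}(K)[2] = 0` (`natCard_two_torsionBy_quadraticTwist_eq_one`: the rational `2`-torsion is
common to the family), so "`#Sel_2(V^{(s)}) = 2` for at least `δ` of the classes" ⟹
"`corank_{ℤ₂} Sel_{2^∞}(V^{(s)}) = 1` for at least `δ` of the classes", granted Cassels–Tate —
the `2`-Selmer-RANK-`1` currency of Heath-Brown / Kane / Smith 2025 Thm. 1.10–1.14 read as a
`2^∞`-corank statement for curves without rational `2`-torsion.
[cite: BhargavaKlagsbrunLemkeOliverShnidman2019, §2 (the proportion of twists)] [cite: Dokchitser2013ParityNotes, §2] -/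
theorem squareClassProportionGe_twist_selmerCorank_one_of_card_selmerGroup_two
    (hCT : exists_casselsTate_pairing (K := K)) (V : WeierstrassCurve K) [V.IsElliptic]
    (hV2 : Nat.card (AddSubgroup.torsionBy V.toAffine.Point (2 : ℤ)) = 1) {δ : ℝ}
    (h : SquareClassProportionGe
      (TwistClassSatisfies V fun E : WeierstrassCurve K ↦ Nat.card (E.selmerGroup 2) = 2) δ) :
    SquareClassProportionGe
      (TwistClassSatisfies V fun E : WeierstrassCurve K ↦ E.selmerCorank 2 = 1) δ := by
  haveI : Fact (Nat.Prime 2) := ⟨Nat.prime_two⟩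
  refine SquareClassProportionGe.mono (fun _ ht (s : Kˣ) hs ↦ ?_) h
  haveI : (V.quadraticTwist (s : K)).IsElliptic := V.isElliptic_quadraticTwist s.ne_zero
  exact selmerCorank_eq_one_of_card_selmerGroup_eq_of_natCard_torsionBy_eq_one hCT _ 2 (ht s hs)
    (natCard_two_torsionBy_quadraticTwist_eq_one V hV2 s.ne_zero)

end Bridge

/-! ## §5 The `19a3` instance: BKLOS 2019 §2 (b) ⟹ `≥ 5/12` of the twists have `corank_{ℤ₃} Sel_{3^∞} = 1` -/

section Cremona19a3

/-- **At least `5/12` of the quadratic twists of `19a3` have `corank_{ℤ₃} Sel_{3^∞}(E_d/ℚ) = 1`**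
(BKLOS height ordering), from the REFEREED BKLOS fact "at least `41.6̄%` have `3`-Selmer rank `1`"
(`BhargavaKlagsbrunLemkeOliverShnidman2019.cremona19a3_rankZero_selmerRankOne_proportions`, clause
(b)) and the Cassels–Tate pairing (`hCT`), by the bridge at `p = 3`. This is the "parity bridge …
off the finitely many classes with rational `3`-torsion" recorded as missing in
`GoldfeldProportionsCremona19a3.lean`. [cite: BhargavaKlagsbrunLemkeOliverShnidman2019, §2 paragraph after Thm. 2.6 (chunk p0005 L40–L41) with Thm. 2.5 (b)]
[cite: SilvermanAEC2009, Thm. X.4.14] -/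
theorem cremona19a3_proportion_selmerCorank_three_eq_one
    (h : BhargavaKlagsbrunLemkeOliverShnidman2019.cremona19a3_rankZero_selmerRankOne_proportions)
    (hCT : exists_casselsTate_pairing (K := ℚ)) :
    SquareClassProportionGe
      (TwistClassSatisfies cremona19a3 fun E : WeierstrassCurve ℚ ↦ E.selmerCorank 3 = 1) (5 / 12) := by
  haveI : Fact (Nat.Prime 3) := ⟨Nat.prime_three⟩
  haveI := cremona19a3_isElliptic
  exact squareClassProportionGe_twist_selmerCorank_one_of_card_selmerGroup hCT cremona19a3 3
    (by norm_num) h.2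

/-- **Keller–Yin 2024b, Cor. 3.8.1, first proportion clause DERIVED from its pointwise clause**:
granted ONLY the pointwise statement "(A) at corank `1`" — every quadratic twist `E_d` of `19a3`
(`d ∈ ℚ^×`) with `corank_{ℤ₃} Sel_{3^∞}(E_d/ℚ) = 1` has `rk E_d(ℚ) = 1 = ord_{s=1} L(E_d, s)` (the
`3`-converse theorems CGLS Thm. E / KY24 / Keller–Yin Thm. 3.7.1, here a HYPOTHESIS `hA`, e.g.
`KellerYin2024.cor381_cremona19a3_twists_OPEN.1 · · 1 (Or.inr rfl)`) — together with BKLOS §2 (b)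
(`h`, REFEREED) and Cassels–Tate (`hCT`), at least `5/12` of the quadratic twists of `19a3` have
algebraic AND analytic rank `1`: the printed "so at least `5/12` (rank `1`) …" is a kernel
consequence, not a free-standing claim. Nothing is asserted about (A).
[cite: KellerYin2024PotOrd, Cor. 3.8.1 (§3.8, chunk p0021 L53–L62)]
[cite: BhargavaKlagsbrunLemkeOliverShnidman2019, §2 paragraph after Thm. 2.6 with Thm. 2.5 (b)] -/
theorem KellerYin2024.cremona19a3_proportion_rank_one_of_pointwise
    (h : BhargavaKlagsbrunLemkeOliverShnidman2019.cremona19a3_rankZero_selmerRankOne_proportions)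
    (hCT : exists_casselsTate_pairing (K := ℚ))
    (hA : ∀ d : ℚ, d ≠ 0 → (cremona19a3.quadraticTwist d).selmerCorank 3 = 1 →
      (cremona19a3.quadraticTwist d).mordellWeilRank = 1 ∧
        (cremona19a3.quadraticTwist d).analyticRank = 1) :
    SquareClassProportionGe
      (TwistClassSatisfies cremona19a3 fun E : WeierstrassCurve ℚ ↦
        E.mordellWeilRank = 1 ∧ E.analyticRank = 1) (5 / 12) :=
  SquareClassProportionGe.mono (fun _ ht (s : ℚˣ) hs ↦ hA (s : ℚ) s.ne_zero (ht s hs))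
    (cremona19a3_proportion_selmerCorank_three_eq_one h hCT)

/-- The same with the tree's PREPRINT claim binder `KellerYin2024.cor381_cremona19a3_twists_OPEN`
supplying (A): its proportion clause "`≥ 5/12` with algebraic and analytic rank `1`" follows from
its own pointwise clause (A), BKLOS §2 (b) and Cassels–Tate. Conditional on the claim; nothing
asserted. [claim: KellerYin2024PotOrd, status: under-review]
[cite: BhargavaKlagsbrunLemkeOliverShnidman2019, §2 paragraph after Thm. 2.6 with Thm. 2.5 (b)] -/
theorem KellerYin2024.cremona19a3_proportion_rank_one_of_cor381_OPEN_pointwise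
    (h : BhargavaKlagsbrunLemkeOliverShnidman2019.cremona19a3_rankZero_selmerRankOne_proportions)
    (hCT : exists_casselsTate_pairing (K := ℚ))
    (h381 : KellerYin2024.cor381_cremona19a3_twists_OPEN) :
    SquareClassProportionGe
      (TwistClassSatisfies cremona19a3 fun E : WeierstrassCurve ℚ ↦
        E.mordellWeilRank = 1 ∧ E.analyticRank = 1) (5 / 12) :=
  KellerYin2024.cremona19a3_proportion_rank_one_of_pointwise h hCT
    fun d hd h1 ↦ h381.1 d hd 1 (Or.inr rfl) h1

end Cremona19a3

/-! ## §6 A positive lower proportion forces infinitely many classes -/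

section Infinite

variable {K : Type u} [Field K] [NumberField K]

/-- **"At least `δ > 0` of the square classes satisfy `P`" forces infinitely many classes with `P`**:
if `{t : P t}` were finite, of size `c`, then `#{t : H(t) < X, P t}/#Σ(X) ≤ c/#Σ(X) → 0`
(`tendsto_natCard_squareClassHeight_lt_atTop_real`), so the `liminf` is `0 < δ`. This is the
passage from BKLOS-type proportions ("a positive proportion of twists") to "infinitely many
twists". [cite: BhargavaKlagsbrunLemkeOliverShnidman2019, §2 (Σ(X), "the proportion of twists E_s having rank 0 is at least …")] -/
theorem SquareClassProportionGe.infinite_setOf {P : SquareClass K → Prop} {δ : ℝ} (hδ : 0 < δ)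
    (h : SquareClassProportionGe P δ) : {t : SquareClass K | P t}.Infinite := by
  intro hfin
  unfold SquareClassProportionGe at h
  set n : ℕ → ℝ := fun X ↦ (Nat.card {t : SquareClass K | squareClassHeight t < X} : ℝ) with hn
  set a : ℕ → ℝ := fun X ↦
    (Nat.card {t : SquareClass K | squareClassHeight t < X ∧ P t} : ℝ) / n X with ha
  change δ ≤ liminf a atTop at h
  -- `0 ≤ a X ≤ c / n X`
  have hnum : ∀ X : ℕ, Nat.card {t : SquareClass K | squareClassHeight t < X ∧ P t} ≤
      hfin.toFinset.card := by
    intro X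
    rw [Nat.card_coe_set_eq, ← Set.ncard_eq_toFinset_card _ hfin]
    exact Set.ncard_le_ncard (fun t ht ↦ ht.2) hfin
  have hn0 : ∀ X : ℕ, 0 ≤ n X := fun X ↦ by simp only [hn]; exact Nat.cast_nonneg _
  have ha0 : ∀ X, 0 ≤ a X := fun X ↦ by
    simp only [ha]
    exact div_nonneg (Nat.cast_nonneg _) (hn0 X)
  have hale : ∀ X, a X ≤ (hfin.toFinset.card : ℝ) / n X := fun X ↦ by
    simp only [ha]
    exact div_le_div_of_nonneg_right (by exact_mod_cast hnum X) (hn0 X)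
  -- `a → 0`, hence `liminf a = 0 < δ`
  have he0 : Tendsto (fun X : ℕ ↦ (hfin.toFinset.card : ℝ) / n X) atTop (𝓝 0) :=
    tendsto_const_nhds.div_atTop tendsto_natCard_squareClassHeight_lt_atTop_real
  have ha_tendsto : Tendsto a atTop (𝓝 0) :=
    tendsto_of_tendsto_of_tendsto_of_le_of_le tendsto_const_nhds he0 ha0 hale
  rw [ha_tendsto.liminf_eq] at h
  exact absurd h (not_le.mpr hδ)

/-- In a twist family: "at least `δ > 0` of the classes `t` have `P(V^{(s)})` for all `[s] = t`"
gives infinitely many such classes, hence (choosing representatives) infinitely many pairwise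
non-`K^{×2}`-equivalent `s ∈ K^×` with `P(V^{(s)})`. [cite: BhargavaKlagsbrunLemkeOliverShnidman2019, §2 (the twists E_s, s ∈ F*/F*²)] -/
theorem infinite_setOf_twistClassSatisfies_of_pos {V : WeierstrassCurve K}
    {P : WeierstrassCurve K → Prop} {δ : ℝ} (hδ : 0 < δ)
    (h : SquareClassProportionGe (TwistClassSatisfies V P) δ) :
    {t : SquareClass K | TwistClassSatisfies V P t}.Infinite :=
  SquareClassProportionGe.infinite_setOf hδ h

/-- **`19a3`: infinitely many square classes of quadratic twists with `corank_{ℤ₃} Sel_{3^∞} = 1`**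
(granted the REFEREED BKLOS fact and Cassels–Tate), from the `≥ 5/12` proportion.
[cite: BhargavaKlagsbrunLemkeOliverShnidman2019, §2 paragraph after Thm. 2.6 (chunk p0005 L41)] -/
theorem cremona19a3_infinite_twistClass_selmerCorank_three_eq_one
    (h : BhargavaKlagsbrunLemkeOliverShnidman2019.cremona19a3_rankZero_selmerRankOne_proportions)
    (hCT : exists_casselsTate_pairing (K := ℚ)) :
    {t : SquareClass ℚ | TwistClassSatisfies cremona19a3
      (fun E : WeierstrassCurve ℚ ↦ E.selmerCorank 3 = 1) t}.Infinite :=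
  SquareClassProportionGe.infinite_setOf (by norm_num)
    (cremona19a3_proportion_selmerCorank_three_eq_one h hCT)

/-- **`19a3`: infinitely many square classes of rank-`0` quadratic twists** (granted the REFEREED
BKLOS fact alone; clause (a), `≥ 1/4`).
[cite: BhargavaKlagsbrunLemkeOliverShnidman2019, §2 paragraph after Thm. 2.6 (chunk p0005 L41), Thm. 2.5 (a)] -/
theorem cremona19a3_infinite_twistClass_rank_zero
    (h : BhargavaKlagsbrunLemkeOliverShnidman2019.cremona19a3_rankZero_selmerRankOne_proportions) :
    {t : SquareClass ℚ | TwistClassSatisfies cremona19a3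
      (fun E : WeierstrassCurve ℚ ↦ E.mordellWeilRank = 0) t}.Infinite :=
  SquareClassProportionGe.infinite_setOf (by norm_num) h.1

end Infinite

/-! ## §7 Burungale–Tian 2026, Thm. 3.5 / Prop. 1.3 in the form "infinitely many twists" -/

section BurungaleTian

/-- **Burungale–Tian 2026 Thm. 3.5 ⟹ infinitely many square classes `t ∈ K^×/(K^×)²` with
`corank_{ℤ₃} Sel_{3^∞}(E^{(t)}/K) = 0`** (`K` imaginary quadratic, `3` not inert, `E/K` with
`End_K ⊋ ℤ`; granted the tree fact `burungaleTian_thm35_selmerCorank_three_twists` = BKLOS Thm. 2.7):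
"at least `50%`" and `SquareClassProportionGe.infinite_setOf`.
[cite: BurungaleTian2026, Thm. 3.5 (§3.2.2, p. 7)] -/
theorem burungaleTian_infinite_twistClass_selmerCorank_three_eq_zero
    (h35 : burungaleTian_thm35_selmerCorank_three_twists) {K : Type} [Field K] [NumberField K]
    (hK : IsImaginaryQuadratic K) (h3 : ¬ (Ideal.span ({3} : Set (𝓞 K))).IsPrime)
    (V : WeierstrassCurve K) [V.IsElliptic] (hCM : V.HasRationalCM) :
    {t : SquareClass K | TwistClassSatisfies V
      (fun E : WeierstrassCurve K ↦ E.selmerCorank 3 = 0) t}.Infinite :=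
  SquareClassProportionGe.infinite_setOf (by norm_num) (h35 K hK h3 V hCM)

/-- **Burungale–Tian 2026 Prop. 1.3 ⟹ infinitely many square classes `t` with
`ord_{s=1} L(s, E^{(t)}/K) = 0`** (same hypotheses; granted the tree fact
`burungaleTian_prop13_analyticRank_twists`). [cite: BurungaleTian2026, Prop. 1.3 (p. 2)] -/
theorem burungaleTian_infinite_twistClass_analyticRank_zero
    (h13 : burungaleTian_prop13_analyticRank_twists) {K : Type} [Field K] [NumberField K]
    (hK : IsImaginaryQuadratic K) (h3 : ¬ (Ideal.span ({3} : Set (𝓞 K))).IsPrime)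
    (V : WeierstrassCurve K) [V.IsElliptic] (hCM : V.HasRationalCM) :
    {t : SquareClass K | TwistClassSatisfies V
      (fun E : WeierstrassCurve K ↦ E.analyticRank = 0) t}.Infinite :=
  SquareClassProportionGe.infinite_setOf (by norm_num) (h13 K hK h3 V hCM)

/-- The same from Thm. 3.5 and the `3`-converse Thm. 1.1 (the printed proof of Prop. 1.3, tree
`burungaleTian_prop13_of_thm35_of_thm11`). [cite: BurungaleTian2026, §3.2.2 "Proof of Proposition 1.3" (p. 7)] -/
theorem burungaleTian_infinite_twistClass_analyticRank_zero_of_thm35_of_thm11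
    (h35 : burungaleTian_thm35_selmerCorank_three_twists)
    (h11 : burungaleTian_analyticRank_eq_zero_of_selmerCorank_eq_zero_of_hasRationalCM)
    {K : Type} [Field K] [NumberField K] (hK : IsImaginaryQuadratic K)
    (h3 : ¬ (Ideal.span ({3} : Set (𝓞 K))).IsPrime) (V : WeierstrassCurve K) [V.IsElliptic]
    (hCM : V.HasRationalCM) :
    {t : SquareClass K | TwistClassSatisfies V
      (fun E : WeierstrassCurve K ↦ E.analyticRank = 0) t}.Infinite :=
  burungaleTian_infinite_twistClass_analyticRank_zero
    (burungaleTian_prop13_of_thm35_of_thm11 h35 h11) hK h3 V hCM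

end BurungaleTian

/-! ## §8 Adding proportions of disjoint properties; Keller–Yin Cor. 3.8.1 (B3) from (B1) + (B2) -/

section Disjoint

variable {K : Type u} [Field K] [NumberField K]

/-- **Lower proportions of DISJOINT properties add**: if no class satisfies both `P` and `Q`, then
"at least `δ₁` of `t` satisfy `P`" and "at least `δ₂` of `t` satisfy `Q`" give "at least `δ₁ + δ₂`
of `t` satisfy `P ∨ Q`" (`#{H<X, P ∨ Q} = #{H<X, P} + #{H<X, Q}` and `liminf` is super-additive).
This is the arithmetic behind "`5/12` (rank `1`) `+ 1/4` (rank `0`) `= 2/3`" (Keller–Yin Cor. 3.8.1)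
and behind every "rank-`0` share + rank-`1` share" assembly of a BSD-rank statement in a twist
family. [cite: KellerYin2024PotOrd, Cor. 3.8.1 (§3.8, chunk p0021 L60–L62: "5/12 (rank 1) + 1/4 (rank 0) = 2/3")]
[cite: BhargavaKlagsbrunLemkeOliverShnidman2019, §2 (the proportion of twists)] -/
theorem SquareClassProportionGe.add_of_disjoint {P Q : SquareClass K → Prop}
    (hPQ : ∀ t, ¬ (P t ∧ Q t)) {δ₁ δ₂ : ℝ} (hP : SquareClassProportionGe P δ₁)
    (hQ : SquareClassProportionGe Q δ₂) :
    SquareClassProportionGe (fun t ↦ P t ∨ Q t) (δ₁ + δ₂) := by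
  unfold SquareClassProportionGe at hP hQ ⊢
  set n : ℕ → ℝ := fun X ↦ (Nat.card {t : SquareClass K | squareClassHeight t < X} : ℝ) with hn
  set a : ℕ → ℝ := fun X ↦
    (Nat.card {t : SquareClass K | squareClassHeight t < X ∧ P t} : ℝ) / n X with ha
  set b : ℕ → ℝ := fun X ↦
    (Nat.card {t : SquareClass K | squareClassHeight t < X ∧ Q t} : ℝ) / n X with hb
  set c : ℕ → ℝ := fun X ↦
    (Nat.card {t : SquareClass K | squareClassHeight t < X ∧ (P t ∨ Q t)} : ℝ) / n X with hc
  change δ₁ ≤ liminf a atTop at hP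
  change δ₂ ≤ liminf b atTop at hQ
  change δ₁ + δ₂ ≤ liminf c atTop
  -- the disjoint-union count `c X = a X + b X`
  have hcount : ∀ X : ℕ, Nat.card {t : SquareClass K | squareClassHeight t < X ∧ (P t ∨ Q t)} =
      Nat.card {t : SquareClass K | squareClassHeight t < X ∧ P t} +
        Nat.card {t : SquareClass K | squareClassHeight t < X ∧ Q t} := by
    intro X
    rw [Nat.card_coe_set_eq, Nat.card_coe_set_eq, Nat.card_coe_set_eq,
      ← Set.ncard_union_eq ?_ (finite_setOf_squareClassHeight_lt_and X P)
        (finite_setOf_squareClassHeight_lt_and X Q)]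
    · congr 1
      ext t
      simp only [Set.mem_setOf_eq, Set.mem_union]
      tauto
    · exact Set.disjoint_left.mpr fun t htP htQ ↦ hPQ t ⟨htP.2, htQ.2⟩
  have hcab : ∀ X, c X = a X + b X := fun X ↦ by
    simp only [ha, hb, hc]
    rw [hcount X, Nat.cast_add, add_div]
  have hn0 : ∀ X : ℕ, 0 ≤ n X := fun X ↦ by simp only [hn]; exact Nat.cast_nonneg _
  have ha0 : ∀ X, 0 ≤ a X := fun X ↦ by simp only [ha]; exact div_nonneg (Nat.cast_nonneg _) (hn0 X)
  have hb0 : ∀ X, 0 ≤ b X := fun X ↦ by simp only [hb]; exact div_nonneg (Nat.cast_nonneg _) (hn0 X)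
  have hc1 : ∀ X, c X ≤ 1 := fun X ↦ by
    simp only [hc, hn]
    refine div_le_one_of_le₀ ?_ (Nat.cast_nonneg _)
    have hsub : {t : SquareClass K | squareClassHeight t < X ∧ (P t ∨ Q t)} ⊆
        {t : SquareClass K | squareClassHeight t < X} := fun t ht ↦ ht.1
    exact_mod_cast Nat.card_mono (finite_setOf_squareClassHeight_lt X) hsub
  refine le_of_forall_lt_imp_le_of_dense fun e he ↦ ?_
  -- split the slack `δ₁ + δ₂ - e > 0` between the two liminfs
  have hε : 0 < (δ₁ + δ₂ - e) / 2 := by linarith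
  have hev₁ : ∀ᶠ X in atTop, δ₁ - (δ₁ + δ₂ - e) / 2 < a X :=
    eventually_lt_of_lt_liminf (by linarith [hP]) (isBoundedUnder_of ⟨0, fun X ↦ ha0 X⟩)
  have hev₂ : ∀ᶠ X in atTop, δ₂ - (δ₁ + δ₂ - e) / 2 < b X :=
    eventually_lt_of_lt_liminf (by linarith [hQ]) (isBoundedUnder_of ⟨0, fun X ↦ hb0 X⟩)
  have hev : ∀ᶠ X in atTop, e ≤ c X := by
    filter_upwards [hev₁, hev₂] with X h₁ h₂
    rw [hcab X]
    linarith
  exact le_liminf_of_le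
    (Filter.IsBoundedUnder.isCoboundedUnder_ge (isBoundedUnder_of ⟨1, fun X ↦ hc1 X⟩)) hev

/-- In a twist family: lower proportions of two pointwise-INCOMPATIBLE curve properties add, giving
the proportion of classes all of whose representatives satisfy `P ∨ Q` (a class has a
representative, so it cannot satisfy both `TwistClassSatisfies V P` and `TwistClassSatisfies V Q`).
[cite: KellerYin2024PotOrd, Cor. 3.8.1 (§3.8, chunk p0021 L60–L62)] -/
theorem squareClassProportionGe_twist_or_of_add {V : WeierstrassCurve K}
    {P Q : WeierstrassCurve K → Prop} (hPQ : ∀ E : WeierstrassCurve K, ¬ (P E ∧ Q E)) {δ₁ δ₂ : ℝ}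
    (hP : SquareClassProportionGe (TwistClassSatisfies V P) δ₁)
    (hQ : SquareClassProportionGe (TwistClassSatisfies V Q) δ₂) :
    SquareClassProportionGe (TwistClassSatisfies V fun E : WeierstrassCurve K ↦ P E ∨ Q E) (δ₁ + δ₂) := by
  have hdisj : ∀ t : SquareClass K, ¬ (TwistClassSatisfies V P t ∧ TwistClassSatisfies V Q t) := by
    rintro t ⟨htP, htQ⟩
    obtain ⟨s, rfl⟩ := QuotientGroup.mk_surjective t
    exact hPQ _ ⟨htP s rfl, htQ s rfl⟩
  refine SquareClassProportionGe.mono (fun t ht (s : Kˣ) hs ↦ ?_)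
    (SquareClassProportionGe.add_of_disjoint hdisj hP hQ)
  rcases ht with ht | ht
  · exact Or.inl (ht s hs)
  · exact Or.inr (ht s hs)

/-- **Keller–Yin 2024b, Cor. 3.8.1, the `2/3` clause DERIVED from the two rank clauses**: "at least
`5/12` (rank `1`) `+ 1/4` (rank `0`) `= 2/3` twists satisfy [`rk = ord_{s=1} L`]" — granted (B1)
"`≥ 5/12` with `rk = an = 1`" (itself a kernel consequence of (A) + BKLOS (b) + Cassels–Tate,
`KellerYin2024.cremona19a3_proportion_rank_one_of_pointwise`) and (B2) "`≥ 1/4` with `rk = an = 0`"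
(hypotheses `h₁`, `h₀`), at least `2/3` of the quadratic twists of `19a3` have `rk E_d(ℚ) =
ord_{s=1} L(E_d, s)`. So of the PREPRINT claim `cor381_cremona19a3_twists_OPEN` only (A) and (B2)
are free-standing. Nothing asserted. [cite: KellerYin2024PotOrd, Cor. 3.8.1 (§3.8, chunk p0021 L60–L62)] -/
theorem KellerYin2024.cremona19a3_proportion_rank_eq_analyticRank_of_clauses
    (h₁ : SquareClassProportionGe
      (TwistClassSatisfies cremona19a3 fun E : WeierstrassCurve ℚ ↦
        E.mordellWeilRank = 1 ∧ E.analyticRank = 1) (5 / 12))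
    (h₀ : SquareClassProportionGe
      (TwistClassSatisfies cremona19a3 fun E : WeierstrassCurve ℚ ↦
        E.mordellWeilRank = 0 ∧ E.analyticRank = 0) (1 / 4)) :
    SquareClassProportionGe
      (TwistClassSatisfies cremona19a3 fun E : WeierstrassCurve ℚ ↦
        E.mordellWeilRank = E.analyticRank) (2 / 3) := by
  have h := squareClassProportionGe_twist_or_of_add (V := cremona19a3)
    (P := fun E : WeierstrassCurve ℚ ↦ E.mordellWeilRank = 1 ∧ E.analyticRank = 1)
    (Q := fun E : WeierstrassCurve ℚ ↦ E.mordellWeilRank = 0 ∧ E.analyticRank = 0)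
    (fun E ⟨hE₁, hE₀⟩ ↦ by omega) h₁ h₀
  rw [show (5 / 12 : ℝ) + 1 / 4 = 2 / 3 by norm_num] at h
  refine SquareClassProportionGe.mono (fun t ht (s : ℚˣ) hs ↦ ?_) h
  rcases ht s hs with ⟨h1, h1'⟩ | ⟨h0, h0'⟩
  · rw [h1, h1']
  · rw [h0, h0']

/-- **Cor. 3.8.1 (B) in full, from (A), (B2), BKLOS (b) and Cassels–Tate**: granted the pointwise
clause (A) at corank `1` (`hA`), the rank-`0` proportion clause (B2) (`h₀`), the REFEREED BKLOS
`19a3` fact and the Cassels–Tate pairing, both remaining proportion clauses (B1) "`≥ 5/12` rank `1`"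
and (B3) "`≥ 2/3` BSD-rank" hold. [cite: KellerYin2024PotOrd, Cor. 3.8.1 (§3.8, chunk p0021 L53–L62)]
[cite: BhargavaKlagsbrunLemkeOliverShnidman2019, §2 paragraph after Thm. 2.6 with Thm. 2.5 (b)] -/
theorem KellerYin2024.cremona19a3_proportions_of_pointwise_of_rank_zero
    (h : BhargavaKlagsbrunLemkeOliverShnidman2019.cremona19a3_rankZero_selmerRankOne_proportions)
    (hCT : exists_casselsTate_pairing (K := ℚ))
    (hA : ∀ d : ℚ, d ≠ 0 → (cremona19a3.quadraticTwist d).selmerCorank 3 = 1 →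
      (cremona19a3.quadraticTwist d).mordellWeilRank = 1 ∧
        (cremona19a3.quadraticTwist d).analyticRank = 1)
    (h₀ : SquareClassProportionGe
      (TwistClassSatisfies cremona19a3 fun E : WeierstrassCurve ℚ ↦
        E.mordellWeilRank = 0 ∧ E.analyticRank = 0) (1 / 4)) :
    SquareClassProportionGe
        (TwistClassSatisfies cremona19a3 fun E : WeierstrassCurve ℚ ↦
          E.mordellWeilRank = 1 ∧ E.analyticRank = 1) (5 / 12) ∧
      SquareClassProportionGe
        (TwistClassSatisfies cremona19a3 fun E : WeierstrassCurve ℚ ↦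
          E.mordellWeilRank = E.analyticRank) (2 / 3) :=
  have h₁ := KellerYin2024.cremona19a3_proportion_rank_one_of_pointwise h hCT hA
  ⟨h₁, KellerYin2024.cremona19a3_proportion_rank_eq_analyticRank_of_clauses h₁ h₀⟩

end Disjoint

end Literature.NumberTheory.EllipticCurves

end
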